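import Mathlib
import Literature.Computability.Complexity.Circuit

/-!
IdeatorSketch1 — crux-ideate stmt-PneNP-10681 (LinAlgGateBlind), ideator 1, round 1 (published copy of the session Sketch.lean).
First lemmas of the two idea cards, stated as `Prop`s over Mathlib + the tree's `Circuit`/`GateFn`
(no sorries; nothing here is claimed proved).
-/

set_option linter.dupNamespace false

namespace Summit.PneNP.PneNP.Cruxes.LinAlgGateBlind.Sketch

open Finset Literature.Computability.Complexity
open scoped Classical

/-! ## Card `theta-budget-flat-certificates` -/

/-- Edge set of the bare `k`-clique on `S`. -/
def cliqueEdges {m : ℕ} (S : Finset (Fin m)) : Set (Sym2 (Fin m)) :=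
  {e | ¬ e.IsDiag ∧ ∀ v ∈ e, v ∈ S}

/-- The matroid-intersection threshold gate on edge sets: accept `G` iff `G` contains a common
independent set of `M₁, M₂` of size `≥ θ` (= one GRANK gate with `K₀ = 0` and rank-one `K_e`,
Edmonds 1967 / Lovász 1989). -/
def miAccepts {m : ℕ} (M₁ M₂ : Matroid (Sym2 (Fin m))) (θ : ℕ) (G : Set (Sym2 (Fin m))) : Prop :=
  ∃ I : Set (Sym2 (Fin m)), I ⊆ G ∧ M₁.Indep I ∧ M₂.Indep I ∧ (θ : ℕ∞) ≤ I.encard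

/-- FIRST LEMMA (card 1, deterministic core; provable now from the matroid intersection theorem and
Turán; matroids on the FULL ground set `Sym2 (Fin m)`, diagonal elements allowed and harmless): if a
matroid-intersection threshold gate accepts every bare `k`-clique, then every REJECTED
edge set is covered by two flats of total rank `< θ`, the cover is `K_k`-free (so, by Turán, it misses
at least `m²/(2(k-1)) - m/2` edges), and the flats are closures of `< θ ≤ k(k-1)/2` edges — hence at
most `(m² + 1)^{2θ}` covers exist, independently of any dimension/representation of the matroids. -/
def FirstLemma_TwoFlatCover : Prop :=
  ∀ (m k θ : ℕ) (M₁ M₂ : Matroid (Sym2 (Fin m))), M₁.E = Set.univ → M₂.E = Set.univ →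
    (∀ S : Finset (Fin m), S.card = k → miAccepts M₁ M₂ θ (cliqueEdges S)) →
    ∀ G : Set (Sym2 (Fin m)), ¬ miAccepts M₁ M₂ θ G →
      ∃ I₁ I₂ : Finset (Sym2 (Fin m)), I₁.card + I₂.card < θ ∧
        G ⊆ M₁.closure ↑I₁ ∪ M₂.closure ↑I₂ ∧
        (SimpleGraph.fromEdgeSet (M₁.closure ↑I₁ ∪ M₂.closure ↑I₂)).CliqueFree k

/-- Union-bound form (card 1, the blindness statement for ONE gate on the referee pair, counting
version): among the edge sets missing exactly `μ` of the `N = m(m-1)/2` edges, the rejected ones are at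
most `(N+1)^{2θ} · C(N - t, μ - t)` with `t = ⌈m²/(2(k-1)) - m/2⌉₊` (each two-flat cover forces a fixed
clique-transversal of size `≥ t` into the missing set). With `μ ≈ N · C ln m / k`, `k = m^δ`,
`δ < 1/2`, this is an `exp(-Ω(m^{3/2}))` fraction. -/
def UnionBound_RejectedAreRare : Prop :=
  ∀ (m k θ μ : ℕ) (M₁ M₂ : Matroid (Sym2 (Fin m))), 2 ≤ k → M₁.E = Set.univ → M₂.E = Set.univ →
    (∀ S : Finset (Fin m), S.card = k → miAccepts M₁ M₂ θ (cliqueEdges S)) →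
    let N := m * (m - 1) / 2
    let t := ⌈(m : ℝ) ^ 2 / (2 * (k - 1)) - m / 2⌉₊
    (Finset.univ.filter (fun G : Finset (Sym2 (Fin m)) =>
        (∀ e ∈ G, ¬ e.IsDiag) ∧ G.card + μ = N ∧ ¬ miAccepts M₁ M₂ θ (G : Set (Sym2 (Fin m))))).card
      ≤ (N + 1) ^ (2 * θ) * Nat.choose (N - t) (μ - t)

/-- Conjectural extension (card 1, the crux-within-the-crux): DIMENSION-FREE MAXTERM COUNT for
non-commutative-rank gates. For a matrix-space gate `Φ(S) = [ncrk(Σ_{i∈S} 𝒦_i) ≥ θ]` on `n` wires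
(each wire `i` controlling a matrix space spanned by `≤ ρ` matrices of rank `≤ ρ`), the number of
MAXIMAL rejected wire sets is `≤ (n+2)^{(θ ρ + 2)^a}` for an absolute `a` — no dependence on the
ambient dimension `d`. Stated with Mathlib's `Matrix.rank` over the generic extension as in the
route file (commutative generic rank; the nc-rank version needs a blow-up, omitted here). -/
def Conjecture_DimensionFreeMaxterms : Prop :=
  ∃ a : ℕ, ∀ (F : Type) (_ : Field F) (n d θ : ℕ) (K : Fin n → Matrix (Fin d) (Fin d) F),
    let Φ : Finset (Fin n) → Prop := fun S => θ ≤ (∑ i ∈ S,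
        (algebraMap (MvPolynomial (Fin n) F) (FractionRing (MvPolynomial (Fin n) F)) (MvPolynomial.X i)) •
          (K i).map (algebraMap F (FractionRing (MvPolynomial (Fin n) F)))).rank
    let ρ := Finset.univ.sup fun i => (K i).rank
    (Finset.univ.filter (fun R : Finset (Fin n) => ¬ Φ R ∧ ∀ i ∉ R, Φ (insert i R))).card
      ≤ (n + 2) ^ ((θ * ρ + 2) ^ a)

/-! ## Card `span-dag-lifting` -/

/-- FIRST LEMMA (card 2, the local step of the rectangle-dag translation, provable now by linear
duality): at a span-program gate (rows `w i`, target `t`) Bob's rejected wire-vector `yb` is refuted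
by ONE functional `λ` (depending on `yb` only) such that every wire `i` with `λ (w i) ≠ 0` is off in
`yb`, while EVERY accepted wire-vector `ya` has an on-wire `i` with `λ (w i) ≠ 0`. So the gate is an
AND (Bob picks the certificate class) of ORs (Alice picks the wire) of its children — a
"certificate-partition node" whose fan-out is the number of hyperplane-maxterm classes met on the
negative sample. -/
def FirstLemma_SpanGateCertificate : Prop :=
  ∀ (F : Type) (_ : Field F) (n d : ℕ) (w : Fin n → (Fin d → F)) (t : Fin d → F)
    (yb : Fin n → Bool), t ∉ Submodule.span F (w '' {i | yb i = true}) →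
    ∃ l : Module.Dual F (Fin d → F),
      (∀ i, l (w i) ≠ 0 → yb i = false) ∧
      ∀ ya : Fin n → Bool, t ∈ Submodule.span F (w '' {i | ya i = true}) → ∃ i, ya i = true ∧ l (w i) ≠ 0

/-- The same local step for a (possibly non-abelian) PERM gate: the certificate is the generated
subgroup itself. Provable now (closure induction). -/
def FirstLemma_PermGateCertificate : Prop :=
  ∀ (n d : ℕ) (σ : Fin n → Equiv.Perm (Fin d)) (τ : Equiv.Perm (Fin d)) (yb : Fin n → Bool),
    τ ∉ Subgroup.closure (σ '' {i | yb i = true}) →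
    ∃ H : Subgroup (Equiv.Perm (Fin d)), τ ∉ H ∧
      (∀ i, σ i ∉ H → yb i = false) ∧
      ∀ ya : Fin n → Bool, τ ∈ Subgroup.closure (σ '' {i | ya i = true}) → ∃ i, ya i = true ∧ σ i ∉ H

/-- Target shape of the line (card 2): a dag-like lifting theorem would bound the size of ANY circuit
over `{∧₂, ∨₂} ∪ Span_F(s)` computing a lifted/projected clique function from below by
`2^{Ω(deg_PC_F)}`. Recorded here only as the MODEL definition the skeleton will need: span-program
gates over a field `F` of dimension `≤ s` as a `Set GateFn` (abelian PERM gates over `ℤ/p` are the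
case `F = ZMod p`). -/
def SpanGates (F : Type) [Field F] (s : ℕ) : Set GateFn :=
  {g | ∃ d : ℕ, d ≤ s ∧ ∃ (w : Fin g.1 → (Fin d → F)) (t : Fin d → F),
    ∀ v : Fin g.1 → Bool, g.2 v = true ↔ t ∈ Submodule.span F (w '' {i | v i = true})}

/-- Sanity (definitional): the translation target is a genuine sub-basis question of the crux — every
`Span (ZMod p) s` gate with `p` prime is a PERM gate on `p · s` points (embed `(ℤ/p)^d` into
`Sym(p d)` by `d` disjoint `p`-cycles), so lower bounds for `{∧,∨} ∪ Span_{𝔽_p}` circuits are the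
abelian case of `LinAlgGateBlind`. Stated, not proved. -/
def SpanIsAbelianPerm : Prop :=
  ∀ (p : ℕ) [Fact p.Prime] (s : ℕ) (g : GateFn), g ∈ SpanGates (ZMod p) s →
    ∃ d : ℕ, d ≤ p * s ∧ ∃ (σ : Fin g.1 → Equiv.Perm (Fin d)) (τ : Equiv.Perm (Fin d)),
      ∀ v : Fin g.1 → Bool, g.2 v = true ↔ τ ∈ Subgroup.closure (σ '' {i | v i = true})

end Summit.PneNP.PneNP.Cruxes.LinAlgGateBlind.Sketch
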